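import Summits.AtomisticToContinuum.Crystallization.Theorems.DisclinationRationUniformPolytypeStabilityDefs
import Summits.AtomisticToContinuum.Crystallization.Theorems.ExcessDecayLiouvilleFarField

/-!
# `UniformPolytypeStability` (stmt-AtomisticToContinuum-15800), line `birth` (v2, cells): stub `stub_pairSum`

Route `DisclinationRation`, crux `UniformPolytypeStability` (uniform harmonic stability of Lennard-Jones layered
polytypes `L(a,s,z)` on the box `a ∈ [47/50, 1]`, gaps in `[39a/50, 17a/20]`), line `birth`
(lead prover-line-stmt-AtomisticToContinuum-15800-0).  This `--supports` file proves the registered stub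

  `stub_pairSum : ∀ a s z, 47/50 ≤ a → a ≤ 1 → IsHaggSeq s → HeightBox a z →
     SitesFacts a s z → PairSumFacts a s z`

over the line vocabulary `…Theorems.DisclinationRationUniformPolytypeStabilityDefs`: for a finitely supported
displacement `u` the crux's two iterated `tsum`s over the site set (`hessForm`, `nnForm`) are honest absolutely
convergent pair sums over `Idx × Idx` of `hessTerm`, `nnTerm` of `U = u ∘ pos`.  Pure bookkeeping:

* transport along the bijection `pos a s z : Idx ≃ Sites a s z` supplied by `SitesFacts` (`Equiv.tsum_eq` twice);
* absolute convergence from a generic comparison lemma (`summable_of_offDiag_bound`: a pair function vanishing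
  off `S × Idx ∪ Idx × S` for a finite `S` and bounded by `C · w x y` with summable rows `w x` is summable), the
  `9/10`-separation of the sites (rows `y ↦ dist(pos y, pos x)⁻⁸` are summable by the far-field lattice-sum bound
  `sum_inv_pow_le_of_separated` of `…Theorems.ExcessDecayLiouvilleFarField`), and the force-constant decay
  `|wᵀK(e)w| ≤ 904‖e‖⁻⁸‖w‖²` for `‖e‖ ≥ 1/2` (`abs_Hess₀_le_inv_pow` of `…PhononStability.Negative.Mirror` plus the
  homogeneity `K(e)(t w) = t² K(e)(w)`);
* Fubini for summable families (`Summable.tsum_prod`).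

The box hypotheses are not used beyond `SitesFacts`.  Everything is `[folklore]`; helper lemmas live in the
sub-namespace `StubPairSum`; nothing here closes an item; no new definitions.
-/

noncomputable section

namespace Summit.AtomisticToContinuum.Crystallization.Theorems.UniformPolytypeStabilityCells

open scoped BigOperators Topology Classical InnerProductSpace
open Filter Set Function
open Literature.MathematicalPhysics.StatisticalMechanics
open Summit.AtomisticToContinuum.Crystallization.Theorems.PhononStabilityNegative
open Summit.AtomisticToContinuum.Crystallization.Theorems.ExcessDecayLiouville (sum_inv_pow_le_of_separated)

namespace StubPairSum

/-! ## Generic comparison: pair functions living near a finite set -/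

/-- **Comparison test for pair sums near a finite set.**  Let `S` be finite and `w x : ι → ℝ` nonnegative summable
rows, symmetric in `(x, y)`.  A pair function `T` that vanishes when both entries are outside `S` and obeys
`|T (x, y)| ≤ C · w x y` whenever one entry is in `S` is summable on `ι × ι`: it is dominated by the finite sum
over `x₀ ∈ S` of the summable "cross" functions `C (𝟙[x = x₀] w x₀ y + w x₀ x 𝟙[y = x₀])`. [folklore] -/
theorem summable_of_offDiag_bound {ι : Type*} (S : Finset ι) (w : ι → ι → ℝ) (hw0 : ∀ x y, 0 ≤ w x y)
    (hws : ∀ x, Summable (w x)) (hsymm : ∀ x y, w x y = w y x) {C : ℝ} (hC : 0 ≤ C) (T : ι × ι → ℝ)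
    (hoff : ∀ x y, x ∉ S → y ∉ S → T (x, y) = 0)
    (hbd : ∀ x y, (x ∈ S ∨ y ∈ S) → |T (x, y)| ≤ C * w x y) : Summable T := by
  classical
  obtain ⟨δ, hδ0, hδ1, hδs⟩ : ∃ δ : ι → ι → ℝ,
      (∀ x₀ t, 0 ≤ δ x₀ t) ∧ (∀ x₀, δ x₀ x₀ = 1) ∧ ∀ x₀, Summable (δ x₀) :=
    ⟨fun x₀ t => if t = x₀ then 1 else 0, fun _ _ => ite_nonneg zero_le_one le_rfl, fun _ => if_pos rfl,
      fun x₀ => (hasSum_ite_eq x₀ (1 : ℝ)).summable⟩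
  set G : ι × ι → ℝ := fun xy => ∑ x₀ ∈ S, C * (δ x₀ xy.1 * w x₀ xy.2 + w x₀ xy.1 * δ x₀ xy.2) with hG
  have hterm : ∀ x₀, Summable fun xy : ι × ι => C * (δ x₀ xy.1 * w x₀ xy.2 + w x₀ xy.1 * δ x₀ xy.2) :=
    fun x₀ => (((hδs x₀).mul_of_nonneg (hws x₀) (fun t => hδ0 x₀ t) fun t => hw0 x₀ t).add
      ((hws x₀).mul_of_nonneg (hδs x₀) (fun t => hw0 x₀ t) fun t => hδ0 x₀ t)).mul_left C
  have hnn : ∀ x₀ (xy : ι × ι), 0 ≤ C * (δ x₀ xy.1 * w x₀ xy.2 + w x₀ xy.1 * δ x₀ xy.2) :=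
    fun x₀ xy => mul_nonneg hC
      (add_nonneg (mul_nonneg (hδ0 _ _) (hw0 _ _)) (mul_nonneg (hw0 _ _) (hδ0 _ _)))
  have hGs : Summable G := summable_sum fun x₀ _ => hterm x₀
  refine Summable.of_norm_bounded hGs ?_
  rintro ⟨x, y⟩
  rw [Real.norm_eq_abs, hG]
  by_cases hx : x ∈ S
  · refine (hbd x y (Or.inl hx)).trans (le_trans ?_ (Finset.single_le_sum (fun x₀ _ => hnn x₀ (x, y)) hx))
    rw [hδ1 x, one_mul]
    exact mul_le_mul_of_nonneg_left (le_add_of_nonneg_right (mul_nonneg (hw0 _ _) (hδ0 _ _))) hC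
  · by_cases hy : y ∈ S
    · refine (hbd x y (Or.inr hy)).trans (le_trans ?_ (Finset.single_le_sum (fun x₀ _ => hnn x₀ (x, y)) hy))
      rw [hδ1 y, mul_one, hsymm x y]
      exact mul_le_mul_of_nonneg_left (le_add_of_nonneg_left (mul_nonneg (hδ0 _ _) (hw0 _ _))) hC
    · rw [hoff x y hx hy, abs_zero]
      exact Finset.sum_nonneg fun x₀ _ => hnn x₀ (x, y)

/-! ## The force-constant form: homogeneity and the `r⁻⁸` bound for all `w` -/

/-- `K(e)` is a quadratic form: `(t w)ᵀ K(e) (t w) = t² · wᵀ K(e) w`. [folklore] -/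
theorem Hess₀_smul_right (e w : EuclideanSpace ℝ (Fin 3)) (t : ℝ) :
    Hess₀ e (t • w) = t ^ 2 * Hess₀ e w := by
  simp only [Hess₀, inner_smul_right, norm_smul, Real.norm_eq_abs, mul_pow, sq_abs, mul_div_assoc]
  ring

/-- For `‖e‖ ≥ 1/2` and every `w`: `|wᵀK(e)w| ≤ 904 ‖e‖⁻⁸ ‖w‖²` (from the unit-vector bound by scaling).
[folklore] -/
theorem abs_Hess₀_le_inv_pow_mul_sq {e : EuclideanSpace ℝ (Fin 3)} (he : (1 / 2 : ℝ) ≤ ‖e‖)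
    (w : EuclideanSpace ℝ (Fin 3)) :
    |Hess₀ e w| ≤ 904 * (‖e‖⁻¹) ^ 8 * ‖w‖ ^ 2 := by
  rcases eq_or_ne w 0 with rfl | hw
  · simp
  have hn : ‖w‖ ≠ 0 := norm_ne_zero_iff.2 hw
  have hpos : 0 < ‖w‖ ^ 2 := by positivity
  have h1 : ‖(‖w‖⁻¹ : ℝ) • w‖ = 1 := by rw [norm_smul, norm_inv, norm_norm, inv_mul_cancel₀ hn]
  have h := abs_Hess₀_le_inv_pow he h1
  rw [Hess₀_smul_right, abs_mul, inv_pow, abs_of_nonneg (inv_nonneg.2 hpos.le),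
    inv_mul_le_iff₀ hpos] at h
  linarith [h]

/-! ## Separated sites: summable inverse eighth powers -/

variable {a : ℝ} {s : ℤ → ℤ} {z : ℤ → ℝ}

/-- Finite partial sums of `dist(pos y, pos x₀)⁻⁸` over `y ≠ x₀` are bounded (by `1024/((9/10)³(9/10)⁵)`), by the
far-field lattice-sum bound over the `9/10`-separated set `pos '' F`. [folklore] -/
theorem sum_inv_dist_pow_le (hinj : Function.Injective (pos a s z))
    (hsep : ∀ x y : Idx, x ≠ y → 9 / 10 ≤ dist (pos a s z x) (pos a s z y)) (x₀ : Idx) (F : Finset Idx)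
    (hF : x₀ ∉ F) :
    ∑ y ∈ F, (dist (pos a s z y) (pos a s z x₀))⁻¹ ^ 8 ≤ 1024 / ((9 / 10 : ℝ) ^ 3 * (9 / 10) ^ 5) := by
  have h := sum_inv_pow_le_of_separated (F.image (pos a s z)) (pos a s z x₀) (k := 5) (δ := 9 / 10)
    (R := 9 / 10) (by norm_num) (by norm_num) le_rfl ?_ ?_
  · rwa [Finset.sum_image fun x _ y _ hxy => hinj hxy] at h
  · intro p hp q hq hpq
    obtain ⟨x, -, rfl⟩ := Finset.mem_image.1 hp
    obtain ⟨y, -, rfl⟩ := Finset.mem_image.1 hq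
    exact hsep x y fun hxy => hpq (congrArg _ hxy)
  · intro p hp
    obtain ⟨y, hy, rfl⟩ := Finset.mem_image.1 hp
    exact hsep y x₀ fun h => hF (h ▸ hy)

/-- For each site index `x₀`, the row `y ↦ dist(pos y, pos x₀)⁻⁸` (set to `0` at `y = x₀`) is summable.
[folklore] -/
theorem summable_inv_dist_pow (hinj : Function.Injective (pos a s z))
    (hsep : ∀ x y : Idx, x ≠ y → 9 / 10 ≤ dist (pos a s z x) (pos a s z y)) (x₀ : Idx) :
    Summable fun y : Idx => if y = x₀ then (0 : ℝ) else (dist (pos a s z y) (pos a s z x₀))⁻¹ ^ 8 := by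
  refine summable_of_sum_le (c := 1024 / ((9 / 10 : ℝ) ^ 3 * (9 / 10) ^ 5))
    (fun y => ite_nonneg le_rfl (by positivity)) (fun F => ?_)
  have h0 : x₀ ∉ F.erase x₀ := fun h => (Finset.mem_erase.1 h).1 rfl
  calc ∑ y ∈ F, (if y = x₀ then (0 : ℝ) else (dist (pos a s z y) (pos a s z x₀))⁻¹ ^ 8)
      = ∑ y ∈ F.erase x₀, (if y = x₀ then (0 : ℝ) else (dist (pos a s z y) (pos a s z x₀))⁻¹ ^ 8) :=
        (Finset.sum_erase F (by simp)).symm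
    _ = ∑ y ∈ F.erase x₀, (dist (pos a s z y) (pos a s z x₀))⁻¹ ^ 8 :=
        Finset.sum_congr rfl fun y hy => if_neg (Finset.mem_erase.1 hy).1
    _ ≤ _ := sum_inv_dist_pow_le hinj hsep x₀ _ h0

/-- Summability of a pair term over site indices from the `r⁻⁸` pair bound near a finite set `S`: `T` vanishes on
the diagonal and when both indices are outside `S`, and `|T (x, y)| ≤ C · dist(pos x, pos y)⁻⁸` otherwise.
[folklore] -/
theorem summable_pair (hinj : Function.Injective (pos a s z))
    (hsep : ∀ x y : Idx, x ≠ y → 9 / 10 ≤ dist (pos a s z x) (pos a s z y)) (S : Finset Idx) {C : ℝ}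
    (hC : 0 ≤ C) (T : Idx × Idx → ℝ) (hoff : ∀ x y, x ∉ S → y ∉ S → T (x, y) = 0)
    (hdiag : ∀ x, T (x, x) = 0)
    (hbd : ∀ x y, x ≠ y → (x ∈ S ∨ y ∈ S) →
      |T (x, y)| ≤ C * (dist (pos a s z x) (pos a s z y))⁻¹ ^ 8) :
    Summable T := by
  refine summable_of_offDiag_bound S
    (fun x y => if y = x then (0 : ℝ) else (dist (pos a s z y) (pos a s z x))⁻¹ ^ 8)
    (fun x y => ite_nonneg le_rfl (by positivity)) (summable_inv_dist_pow hinj hsep) (fun x y => ?_) hC T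
    hoff (fun x y hxy => ?_)
  · by_cases h : y = x
    · subst h; rfl
    · rw [if_neg h, if_neg (Ne.symm h), dist_comm]
  · by_cases h : x = y
    · subst h
      rw [hdiag, abs_zero, if_pos rfl, mul_zero]
    · rw [if_neg (Ne.symm h), dist_comm]
      exact hbd x y h hxy

/-! ## The two pair terms of the line -/

/-- `‖U x − U y‖² ≤ (2 Σ_{t ∈ S} ‖U t‖)²` when `U` vanishes off `S`. [folklore] -/
theorem norm_sub_sq_le (U : Idx → EuclideanSpace ℝ (Fin 3)) (S : Finset Idx) (hmem : ∀ x, x ∉ S → U x = 0)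
    (x y : Idx) :
    ‖U x - U y‖ ^ 2 ≤ (2 * ∑ t ∈ S, ‖U t‖) ^ 2 := by
  have hM : ∀ t, ‖U t‖ ≤ ∑ t ∈ S, ‖U t‖ := fun t => by
    by_cases ht : t ∈ S
    · exact Finset.single_le_sum (fun r _ => norm_nonneg (U r)) ht
    · rw [hmem t ht, norm_zero]
      exact Finset.sum_nonneg fun r _ => norm_nonneg (U r)
  have h : ‖U x - U y‖ ≤ 2 * ∑ t ∈ S, ‖U t‖ := (norm_sub_le _ _).trans (by linarith [hM x, hM y])
  exact pow_le_pow_left₀ (norm_nonneg _) h 2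

/-- The second-variation pair term of a finitely supported `U` is absolutely summable over `Idx × Idx`. [folklore] -/
theorem summable_hessTerm (hinj : Function.Injective (pos a s z))
    (hsep : ∀ x y : Idx, x ≠ y → 9 / 10 ≤ dist (pos a s z x) (pos a s z y))
    (U : Idx → EuclideanSpace ℝ (Fin 3)) (hU : (Function.support U).Finite) :
    Summable (hessTerm a s z U) := by
  have hmem : ∀ x, x ∉ hU.toFinset → U x = 0 := fun x hx => by simpa using hx
  set M : ℝ := ∑ t ∈ hU.toFinset, ‖U t‖
  refine summable_pair hinj hsep hU.toFinset (C := 904 * (2 * M) ^ 2) (by positivity) _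
    (fun x y hx hy => ?_) (fun x => ?_) (fun x y hxy _ => ?_)
  · simp [hessTerm, hmem x hx, hmem y hy]
  · simp [hessTerm]
  · have hd := hsep x y hxy
    rw [dist_eq_norm] at hd ⊢
    have he : (1 / 2 : ℝ) ≤ ‖pos a s z x - pos a s z y‖ := by linarith
    rw [show hessTerm a s z U (x, y) = Hess₀ (pos a s z x - pos a s z y) (U x - U y) from if_pos hxy]
    calc |Hess₀ (pos a s z x - pos a s z y) (U x - U y)|
        ≤ 904 * (‖pos a s z x - pos a s z y‖⁻¹) ^ 8 * ‖U x - U y‖ ^ 2 :=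
          abs_Hess₀_le_inv_pow_mul_sq he _
      _ ≤ 904 * (‖pos a s z x - pos a s z y‖⁻¹) ^ 8 * (2 * M) ^ 2 :=
          mul_le_mul_of_nonneg_left (norm_sub_sq_le U _ hmem x y) (by positivity)
      _ = 904 * (2 * M) ^ 2 * (‖pos a s z x - pos a s z y‖⁻¹) ^ 8 := by ring

/-- The nearest-neighbour pair term of a finitely supported `U` is absolutely summable over `Idx × Idx`. [folklore] -/
theorem summable_nnTerm (hinj : Function.Injective (pos a s z))
    (hsep : ∀ x y : Idx, x ≠ y → 9 / 10 ≤ dist (pos a s z x) (pos a s z y))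
    (U : Idx → EuclideanSpace ℝ (Fin 3)) (hU : (Function.support U).Finite) :
    Summable (nnTerm a s z U) := by
  have hmem : ∀ x, x ∉ hU.toFinset → U x = 0 := fun x hx => by simpa using hx
  set M : ℝ := ∑ t ∈ hU.toFinset, ‖U t‖
  refine summable_pair hinj hsep hU.toFinset (C := (2 * M) ^ 2 * (11 / 10) ^ 8) (by positivity) _
    (fun x y hx hy => ?_) (fun x => ?_) (fun x y hxy _ => ?_)
  · simp [nnTerm, hmem x hx, hmem y hy]
  · simp [nnTerm]
  · by_cases hle : dist (pos a s z x) (pos a s z y) ≤ 11 / 10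
    · rw [show nnTerm a s z U (x, y) = ‖U x - U y‖ ^ 2 from if_pos hle, abs_of_nonneg (sq_nonneg _)]
      have hd := hsep x y hxy
      have hpos : 0 < dist (pos a s z x) (pos a s z y) := by linarith
      have h1 : 1 ≤ 11 / 10 * (dist (pos a s z x) (pos a s z y))⁻¹ := by
        rw [← div_eq_mul_inv, le_div_iff₀ hpos, one_mul]; exact hle
      calc ‖U x - U y‖ ^ 2 ≤ (2 * M) ^ 2 * 1 := by rw [mul_one]; exact norm_sub_sq_le U _ hmem x y
        _ ≤ (2 * M) ^ 2 * (11 / 10 * (dist (pos a s z x) (pos a s z y))⁻¹) ^ 8 :=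
            mul_le_mul_of_nonneg_left (one_le_pow₀ h1) (sq_nonneg _)
        _ = (2 * M) ^ 2 * (11 / 10) ^ 8 * (dist (pos a s z x) (pos a s z y))⁻¹ ^ 8 := by ring
    · rw [show nnTerm a s z U (x, y) = 0 from if_neg hle, abs_zero]
      positivity

/-! ## Transport along `pos : Idx ≃ Sites` -/

/-- A double `tsum` over the site set is the double `tsum` over site indices, along the bijection `pos`. [folklore] -/
theorem tsum_sites_eq (hinj : Function.Injective (pos a s z)) (hrange : Set.range (pos a s z) = Sites a s z)
    (f : EuclideanSpace ℝ (Fin 3) → EuclideanSpace ℝ (Fin 3) → ℝ) :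
    ∑' p : Sites a s z, ∑' q : Sites a s z, f p q =
      ∑' x : Idx, ∑' y : Idx, f (pos a s z x) (pos a s z y) := by
  obtain ⟨e, he⟩ :
      ∃ e : Idx ≃ Sites a s z, ∀ x, ((e x : Sites a s z) : EuclideanSpace ℝ (Fin 3)) = pos a s z x :=
    ⟨(Equiv.ofInjective _ hinj).trans (Equiv.setCongr hrange), fun _ => rfl⟩
  calc ∑' p : Sites a s z, ∑' q : Sites a s z, f p q
      = ∑' x : Idx, ∑' q : Sites a s z, f (e x) q :=
        (e.tsum_eq fun p : Sites a s z => ∑' q : Sites a s z, f p q).symm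
    _ = ∑' x : Idx, ∑' y : Idx, f (e x) (e y) :=
        tsum_congr fun x => (e.tsum_eq fun q : Sites a s z => f (e x) q).symm
    _ = _ := by simp only [he]

end StubPairSum

open StubPairSum in
/-- **Stub `stub_pairSum`** (registered signature): on the box, given the index picture `SitesFacts a s z`, the
crux's iterated `tsum`s `hessForm`, `nnForm` of a finitely supported displacement `u` are the absolutely
convergent pair sums over `Idx × Idx` of `hessTerm`, `nnTerm` of `U = u ∘ pos`. [folklore] -/
theorem stub_pairSum : ∀ (a : ℝ) (s : ℤ → ℤ) (z : ℤ → ℝ), 47 / 50 ≤ a → a ≤ 1 → IsHaggSeq s →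
    HeightBox a z → SitesFacts a s z → PairSumFacts a s z := by
  intro a s z _ _ _ _ hS u hu _
  obtain ⟨hinj, hrange, hsep, -, -⟩ := hS
  have hU : (Function.support (u ∘ pos a s z)).Finite := by
    rw [Function.support_comp_eq_preimage]
    exact hu.preimage hinj.injOn
  have hH := summable_hessTerm hinj hsep (u ∘ pos a s z) hU
  have hN := summable_nnTerm hinj hsep (u ∘ pos a s z) hU
  refine ⟨hH, ?_, hN, ?_⟩
  · rw [hH.tsum_prod, hessForm,
      tsum_sites_eq hinj hrange fun p q => if p ≠ q then Hess₀ (p - q) (u p - u q) else 0]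
    refine tsum_congr fun x => tsum_congr fun y => ?_
    by_cases hxy : x = y
    · subst hxy; simp [hessTerm]
    · simp [hessTerm, hxy, hinj.ne hxy]
  · rw [hN.tsum_prod, nnForm,
      tsum_sites_eq hinj hrange fun p q => if dist p q ≤ 11 / 10 then ‖u p - u q‖ ^ 2 else 0]
    simp only [nnTerm, Function.comp_apply]

end Summit.AtomisticToContinuum.Crystallization.Theorems.UniformPolytypeStabilityCells

end
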